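import Literature.Computability.Complexity.GaussRankFP
import Literature.Computability.Complexity.LengthCompare
import Literature.Computability.MetaComplexity.SmolenskyRows
import HarnessLib

/-!
# The Razborov–Smolensky natural property is `P`-natural (constructivity, and the package)

Final instalment of the `Smolensky*` files (groundwork for the named fact
`Literature.Computability.Learning.cikk_learn_AC0Mod`, CIKK 2016 Cor. 5.4, via CIKK Thm. 5.3). The
decision function `rsDecide p` of `SmolenskyRows.lean` — length, doubling fold, parity, block reads
of the truth table, the `2·2ᵐ` explicit rows, the list rank of `GaussRankList.lean`, a comparison —
is assembled in the typed algebra `CodeFP` (`CodeFP.lean`, `CodeFPArith.lean`, `CodeFPLists.lean`,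
`GaussRankFP.lean`), whence the truth-table language of `rsProperty p` is in `P`:

* `codeFP_log2Fold`, `codeFP_bitsOf`, `codeFP_popc`, `codeFP_subsetB`, `codeFP_monoEntry`,
  `codeFP_monosU`, `codeFP_propRowsU`, `codeFP_propTestU`, `codeFP_glBlocks`, `codeFP_rsDecide`;
* **`isConstructive_rsProperty : IsConstructive P (rsProperty p)`**;
* **`rsProperty_natural`**: for every prime `p`, `rsProperty p` is `P`-natural with density `1/2`
  at every length and useful against `AC⁰[p]` — Razborov–Rudich 1997, §3.2 ("the lower bounds of
  Razborov and Smolensky are natural") / CIKK 2016, Thm. 5.3, fully proved, for all primes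
  including `2`.

All statements are proved; no named facts are introduced.

## References

* A. A. Razborov, S. Rudich, *Natural proofs*, JCSS 55 (1997), §3.2 [RazborovRudich1997].
* M. Carmosino, R. Impagliazzo, V. Kabanets, A. Kolokolova, *Learning algorithms from natural
  proofs*, CCC 2016, Thm. 5.3 [CarmosinoImpagliazzoKabanetsKolokolova2016].
* S. Arora, B. Barak, *Computational Complexity: A Modern Approach*, CUP 2009, §1.3
  [AroraBarak2009].
-/

namespace Literature.Computability.MetaComplexity

open _root_.Computability Polynomial Literature.Computability.Complexity
  Literature.Computability.Complexity.CodeFP Literature.Computability.Complexity.GaussRank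
  Literature.Computability.Complexity.Brick

namespace Smolensky

variable {p : ℕ} [Fact p.Prime]

/-! ### Semantic facts about the doubling fold -/

/-- Along the doubling fold the power stays `≤ max L 1` and the exponent grows by at most one per
step. [folklore] -/
theorem foldl_log2Step_le (L : ℕ) (l : List Unit) : ∀ (st : ℕ × ℕ), st.1 ≤ max L 1 →
    (l.foldl (log2Step L) st).1 ≤ max L 1 ∧ (l.foldl (log2Step L) st).2 ≤ st.2 + l.length := by
  induction l with
  | nil => intro st h; exact ⟨h, by simp⟩
  | cons u l ih =>
    intro st h
    rw [List.foldl_cons, List.length_cons]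
    have h1 : (log2Step L st u).1 ≤ max L 1 ∧ (log2Step L st u).2 ≤ st.2 + 1 := by
      unfold log2Step
      split_ifs with hc
      · exact ⟨le_max_of_le_left hc, le_rfl⟩
      · exact ⟨h, Nat.le_succ _⟩
    have h2 := ih _ h1.1
    exact ⟨h2.1, by omega⟩

/-- The first component of `log2Fold` is `2^(second)`. [folklore] -/
theorem log2Fold_fst (L : ℕ) : (log2Fold L).1 = 2 ^ (log2Fold L).2 := by
  rcases Nat.eq_zero_or_pos L with rfl | hL
  · rfl
  · rw [log2Fold_eq hL]

/-- The exponent of `log2Fold` is at most `L`. [folklore] -/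
theorem log2Fold_snd_le (L : ℕ) : (log2Fold L).2 ≤ L := by
  rcases Nat.eq_zero_or_pos L with rfl | hL
  · exact le_rfl
  · rw [log2Fold_eq hL]; exact Nat.log_le_self 2 L

/-- The power of `log2Fold` is at most `L + 1`. [folklore] -/
theorem log2Fold_fst_le (L : ℕ) : (log2Fold L).1 ≤ L + 1 := by
  rcases Nat.eq_zero_or_pos L with rfl | hL
  · exact le_rfl
  · rw [log2Fold_eq hL]; exact (Nat.pow_log_le_self 2 hL.ne').trans (Nat.le_succ L)

/-- `2^(n-1) ≤ L + 1` for the exponent `n` of `log2Fold L`. [folklore] -/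
theorem two_pow_pred_log2Fold_le (L : ℕ) : 2 ^ ((log2Fold L).2 - 1) ≤ L + 1 :=
  (Nat.pow_le_pow_right two_pos (Nat.sub_le _ _)).trans (log2Fold_fst L ▸ log2Fold_fst_le L)

/-! ### The doubling fold on codes -/

/-- **`w ↦ log2Fold |w|` on codes** (a fold over a budget of `|w|` units). [folklore] -/
theorem codeFP_log2Fold : CodeFP strE (pairE natE natE) (fun w => log2Fold w.length) := by
  have hL : CodeFP (pairE natE (pairE unitE (pairE natE natE))) natE (fun t => t.1) := fst _ _
  have hst : CodeFP (pairE natE (pairE unitE (pairE natE natE))) (pairE natE natE) (fun t => t.2.2) :=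
    (snd _ _).snd'
  have hdbl : CodeFP (pairE natE (pairE unitE (pairE natE natE))) natE (fun t => t.2.2.1 * 2) :=
    natMul.comp (hst.fst'.pair (const _ 2))
  have hstep : CodeFP (pairE natE (pairE unitE (pairE natE natE))) (pairE natE natE)
      (fun t => log2Step t.1 t.2.2 t.2.1) :=
    ((natLe.comp (hdbl.pair hL)).ite (hdbl.pair (natAdd.comp (hst.snd'.pair (const _ 1)))) hst).congr
      fun t => by unfold log2Step; simp only [decide_eq_true_eq]
  have h := foldl (σ := ℕ) (α := Unit) (β := ℕ × ℕ) (eσ := natE) (eα := unitE)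
    (eβ := pairE natE natE) (step := fun L u st => log2Step L st u) (init := fun _ => (1, 0))
    hstep (const natE (1, 0)) (2 * X + 4) (fun L l₁ l₂ => by
      have hinv := foldl_log2Step_le L l₁ (1, 0) (le_max_right _ _)
      have hst' : l₁.foldl (fun st u => log2Step L st u) (1, 0) = l₁.foldl (log2Step L) (1, 0) := rfl
      rw [hst']
      generalize l₁.foldl (log2Step L) (1, 0) = st at hinv ⊢
      obtain ⟨h1, h2⟩ := hinv
      simp only [pairE_apply, length_boolPair, eval_add, eval_mul, eval_ofNat, eval_X]
      have h3 : (natE st.1).length ≤ (natE L).length + 1 := by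
        rcases Nat.eq_zero_or_pos L with rfl | hL
        · have : st.1 ≤ 1 := by simpa using h1
          interval_cases st.1 <;> decide
        · rw [max_eq_left hL] at h1
          exact (length_encodeNat_mono h1).trans (Nat.le_succ _)
      have h4 : (natE st.2).length ≤ l₁.length := (length_natE_le _).trans (by simpa using h2)
      have h5 : l₁.length ≤ (rawE unitE (l₁ ++ l₂)).length :=
        le_trans (by simp) (length_le_length_rawE _ _)
      omega)
  exact (h.comp (strNatLength.pair (replicateUnit.comp strLength))).congr fun _ => rfl

/-! ### Bits, counts, mask inclusion on codes -/

/-- `(1ᵐ, s) ↦ bitsOf m s` on codes (the halving fold). [folklore] -/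
theorem codeFP_bitsOf : CodeFP (pairE unE natE) (rawE bitE) (fun q => bitsOf q.1 q.2) := by
  have hst : CodeFP (pairE natE (pairE unitE (pairE natE (rawE bitE)))) (pairE natE (rawE bitE))
      (fun t => t.2.2) := (snd _ _).snd'
  have hstep : CodeFP (pairE natE (pairE unitE (pairE natE (rawE bitE)))) (pairE natE (rawE bitE))
      (fun t => halfStep t.2.2 t.2.1) :=
    (natDiv.comp (hst.fst'.pair (const _ 2))).pair ((rawAppend bitE).comp (hst.snd'.pair
      ((rawSingleton bitE).comp (natEq.comp ((natMod.comp (hst.fst'.pair (const _ 2))).pair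
        (const _ 1))))))
  have hinit : CodeFP natE (pairE natE (rawE bitE)) (fun s => (s, ([] : List Bool))) :=
    (CodeFP.id natE).pair (const natE [])
  have h := foldl (σ := ℕ) (α := Unit) (β := ℕ × List Bool) (eσ := natE) (eα := unitE)
    (eβ := pairE natE (rawE bitE)) (step := fun _ u st => halfStep st u) (init := fun s => (s, []))
    hstep hinit (2 * X) (fun s l₁ l₂ => by
      have hrep : l₁ = List.replicate l₁.length () := List.eq_replicate_iff.2 ⟨rfl, fun _ _ => rfl⟩
      have hfold : l₁.foldl (fun st u => halfStep st u) (s, []) =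
          (s / 2 ^ l₁.length, List.ofFn fun i : Fin l₁.length => s.testBit i) := by
        conv_lhs => rw [hrep]
        rw [show (fun st u => halfStep st u) = halfStep from rfl, foldl_halfStep, List.nil_append]
      rw [hfold]
      simp only [pairE_apply, length_boolPair, eval_mul, eval_ofNat, eval_X, length_rawE]
      have h1 : (natE (s / 2 ^ l₁.length)).length ≤ (natE s).length :=
        length_encodeNat_mono (Nat.div_le_self _ _)
      have h2 : ((List.ofFn fun i : Fin l₁.length => s.testBit i).map fun a => 2 * (bitE a).length + 2).sum
          = 4 * l₁.length := by
        simp [bitE, List.sum_ofFn, mul_comm]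
      have h3 : 2 * l₁.length ≤ ((l₁ ++ l₂).map fun a => 2 * (unitE a).length + 2).sum := by
        simp [unitE]
        omega
      omega)
  exact (h.comp ((snd unE natE).pair (replicateUnit.comp (fst unE natE)))).snd'.congr fun _ => rfl

/-- The counting fold is `countP id`. [folklore] -/
theorem foldl_countBits (l : List Bool) (k : ℕ) :
    l.foldl (fun k b => if b then k + 1 else k) k = k + l.countP id := by
  induction l generalizing k with
  | nil => simp
  | cons b l ih => rw [List.foldl_cons, ih, List.countP_cons]; cases b <;> simp; omega

/-- Counting the ones of a bit list on codes. [folklore] -/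
theorem codeFP_countBits : CodeFP (rawE bitE) natE (fun l => l.countP id) := by
  have hstep : CodeFP (pairE bitE natE) natE (fun t => if t.1 then t.2 + 1 else t.2) :=
    (fst _ _).ite (natAdd.comp ((snd _ _).pair (const _ 1))) (snd _ _)
  have h := foldl₀ (α := Bool) (β := ℕ) (eα := bitE) (eβ := natE)
    (step := fun b k => if b then k + 1 else k) (b₀ := 0) hstep X (fun l₁ l₂ => by
      rw [foldl_countBits, Nat.zero_add, eval_X]
      exact (length_natE_le _).trans ((List.countP_le_length).trans
        (le_trans (by simp) (length_le_length_rawE _ _))))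
  exact h.congr fun l => by rw [foldl_countBits, Nat.zero_add]

/-- `(1ᵐ, s) ↦ popc m s` on codes. [folklore] -/
theorem codeFP_popc : CodeFP (pairE unE natE) natE (fun q => popc q.1 q.2) :=
  (codeFP_countBits.comp codeFP_bitsOf).congr fun _ => rfl

/-- `(1ᵐ, s, k) ↦ subsetB m s k` on codes. [folklore] -/
theorem codeFP_subsetB : CodeFP (pairE unE (pairE natE natE)) bitE (fun q => subsetB q.1 q.2.1 q.2.2) := by
  have hg : CodeFP (pairE unitE (pairE bitE bitE)) bitE (fun t => !t.2.1 || t.2.2) :=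
    (snd _ _).fst'.not.or (snd _ _).snd'
  have hz := zipWith (σ := Unit) (eσ := unitE) (eα := bitE) (eβ := bitE) (eγ := bitE)
    (g := fun t => !t.2.1 || t.2.2) hg
  have hall := all (σ := Unit) (eσ := unitE) (eα := bitE) (p := fun t => t.2) (snd _ _)
  have hs : CodeFP (pairE unE (pairE natE natE)) (rawE bitE) (fun q => bitsOf q.1 q.2.1) :=
    (codeFP_bitsOf.comp ((fst _ _).pair (snd _ _).fst')).congr fun _ => rfl
  have hk : CodeFP (pairE unE (pairE natE natE)) (rawE bitE) (fun q => bitsOf q.1 q.2.2) :=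
    (codeFP_bitsOf.comp ((fst _ _).pair (snd _ _).snd')).congr fun _ => rfl
  exact (hall.comp ((const _ ()).pair (hz.comp ((const _ ()).pair (hs.pair hk))))).congr fun _ => rfl

/-! ### The rows on codes -/

/-- `(1ᵐ, s, k) ↦ monoEntry m s k` on codes. [folklore] -/
theorem codeFP_monoEntry :
    CodeFP (pairE unE (pairE natE natE)) (zmodE p) (fun q => monoEntry (ZMod p) q.1 q.2.1 q.2.2) := by
  have hpc : CodeFP (pairE unE (pairE natE natE)) natE (fun q => popc q.1 q.2.1) :=
    (codeFP_popc.comp ((fst _ _).pair (snd _ _).fst')).congr fun _ => rfl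
  have hhalf : CodeFP (pairE unE (pairE natE natE)) natE (fun q => q.1 / 2) :=
    natDiv.comp ((natOfUn.comp (fst _ _)).pair (const _ 2))
  exact (((natLe.comp (hpc.pair hhalf)).and codeFP_subsetB).ite (const _ (1 : ZMod p))
    (const _ (0 : ZMod p))).congr fun _ => rfl

/-- The monomial rows with an explicit column count `M` (`= monos` for `M = 2ᵐ`). [folklore] -/
def monosU (F : Type*) [Field F] (m M : ℕ) : List (List F) :=
  (List.range M).map fun s => (List.range M).map (monoEntry F m s)

/-- The rows with an explicit column count. [folklore] -/
def propRowsU (F : Type*) [Field F] (m M : ℕ) (gl : List F) : List (List F) :=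
  monosU F m M ++ (monosU F m M).map fun mr => List.zipWith (· * ·) gl mr

/-- The test with an explicit column count. [folklore] -/
def propTestU (F : Type*) [Field F] [DecidableEq F] (m M : ℕ) (gl : List F) : Bool :=
  decide (3 * M ≤ 4 * lrank M (propRowsU F m M gl))

omit [Fact p.Prime] in
/-- At `M = 2ᵐ` the explicit-count rows are `monos`. [folklore] -/
theorem monosU_two_pow {F : Type*} [Field F] (m : ℕ) : monosU F m (2 ^ m) = monos F m := by
  unfold monosU monos monoRow
  rfl

omit [Fact p.Prime] in
/-- At `M = 2ᵐ` the explicit-count rows are `propRows`. [folklore] -/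
theorem propRowsU_two_pow {F : Type*} [Field F] (m : ℕ) (gl : List F) :
    propRowsU F m (2 ^ m) gl = propRows m gl := by
  rw [propRowsU, monosU_two_pow]
  rfl

omit [Fact p.Prime] in
/-- At `M = 2ᵐ` the explicit-count test is `propTest`. [folklore] -/
theorem propTestU_two_pow {F : Type*} [Field F] [DecidableEq F] (m : ℕ) (gl : List F) :
    propTestU F m (2 ^ m) gl = propTest m gl := by
  rw [propTestU, propRowsU_two_pow]
  rfl

/-- `(1ᵐ, 1ᴹ) ↦ monosU m M` on codes. [folklore] -/
theorem codeFP_monosU : CodeFP (pairE unE unE) (rawE (rowE p)) (fun q => monosU (ZMod p) q.1 q.2) := by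
  -- one row, context `(1ᵐ, s)`, items the columns `k`
  have h1 : CodeFP (pairE (pairE unE natE) natE) (pairE unE (pairE natE natE))
      (fun t => (t.1.1, (t.1.2, t.2))) := (fst _ _).fst'.pair ((fst _ _).snd'.pair (snd _ _))
  have hg : CodeFP (pairE (pairE unE natE) natE) (zmodE p) (fun t => monoEntry (ZMod p) t.1.1 t.1.2 t.2) :=
    (codeFP_monoEntry.comp h1).congr fun _ => rfl
  have hrow := map (σ := ℕ × ℕ) (eσ := pairE unE natE) (eα := natE) (eβ := zmodE p)
    (g := fun t => monoEntry (ZMod p) t.1.1 t.1.2 t.2) hg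
  -- `(1ᵐ, 1ᴹ, s) ↦ row s`
  have hrow' : CodeFP (pairE (pairE unE unE) natE) (rowE p)
      (fun t => (List.range t.1.2).map (monoEntry (ZMod p) t.1.1 t.2)) :=
    (hrow.comp (((fst _ _).fst'.pair (snd _ _)).pair (urange.comp (fst _ _).snd'))).congr fun _ => rfl
  have hall := map (σ := ℕ × ℕ) (eσ := pairE unE unE) (eα := natE) (eβ := rowE p)
    (g := fun t => (List.range t.1.2).map (monoEntry (ZMod p) t.1.1 t.2)) hrow'
  exact (hall.comp ((CodeFP.id _).pair (urange.comp (snd _ _)))).congr fun _ => rfl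

/-- Entrywise product of two rows on codes. [folklore] -/
theorem codeFP_zipMul : CodeFP (pairE (rowE p) (rowE p)) (rowE p) (fun t => List.zipWith (· * ·) t.1 t.2) := by
  have hg : CodeFP (pairE unitE (pairE (zmodE p) (zmodE p))) (zmodE p) (fun t => t.2.1 * t.2.2) :=
    zmodMul.comp ((snd _ _).fst'.pair (snd _ _).snd')
  exact ((zipWith (σ := Unit) (eσ := unitE) (eα := zmodE p) (eβ := zmodE p) (eγ := zmodE p)
    (g := fun t => t.2.1 * t.2.2) hg).comp ((const _ ()).pair (CodeFP.id _))).congr fun _ => rfl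

/-- `((1ᵐ, 1ᴹ), gl) ↦ propRowsU m M gl` on codes. [folklore] -/
theorem codeFP_propRowsU :
    CodeFP (pairE (pairE unE unE) (rowE p)) (rawE (rowE p)) (fun q => propRowsU (ZMod p) q.1.1 q.1.2 q.2) := by
  have hmonos : CodeFP (pairE (pairE unE unE) (rowE p)) (rawE (rowE p))
      (fun q => monosU (ZMod p) q.1.1 q.1.2) := (codeFP_monosU.comp (fst _ _)).congr fun _ => rfl
  have hz := map (σ := List (ZMod p)) (eσ := rowE p) (eα := rowE p) (eβ := rowE p)
    (g := fun t => List.zipWith (· * ·) t.1 t.2) codeFP_zipMul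
  exact ((rawAppend (rowE p)).comp (hmonos.pair (hz.comp ((snd _ _).pair hmonos)))).congr fun _ => rfl

/-- `((1ᵐ, 1ᴹ), gl) ↦ propTestU m M gl` on codes. [folklore] -/
theorem codeFP_propTestU :
    CodeFP (pairE (pairE unE unE) (rowE p)) bitE (fun q => propTestU (ZMod p) q.1.1 q.1.2 q.2) := by
  have hr : CodeFP (pairE (pairE unE unE) (rowE p)) natE
      (fun q => lrank q.1.2 (propRowsU (ZMod p) q.1.1 q.1.2 q.2)) :=
    (codeFP_lrank.comp ((fst _ _).snd'.pair codeFP_propRowsU)).congr fun _ => rfl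
  have hM : CodeFP (pairE (pairE unE unE) (rowE p)) natE (fun q => q.1.2) := natOfUn.comp (fst _ _).snd'
  exact (natLe.comp ((natMul.comp ((const _ 3).pair hM)).pair (natMul.comp ((const _ 4).pair hr)))).congr
    fun q => rfl

/-! ### Reading the value lists off the input string -/

/-- The value of a block: its first bit as `0/1 ∈ 𝔽_p`. [folklore] -/
theorem codeFP_bitOfBlock : CodeFP strE (zmodE p) (bitOfBlock (ZMod p)) :=
  (zmodOfNat.comp (strVal.comp (strTake.comp ((const strE 1).pair (CodeFP.id strE))))).congr fun blk => by
    cases blk with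
    | nil => simp [bitOfBlock]
    | cons b l => cases b <;> simp [bitOfBlock]

/-- The value lists of the blocks of a string: `(1ᴹ, 1ᵏ, w) ↦ [bitOfBlock (w[ik, ik+k))]_{i<M}`.
[folklore] -/
theorem codeFP_glBlocks : CodeFP (pairE unE (pairE unE strE)) (rowE p)
    (fun q => (List.range q.1).map fun i => bitOfBlock (ZMod p) ((q.2.2.drop (i * q.2.1)).take q.2.1)) :=
  ((map₀ codeFP_bitOfBlock).comp strChunks).congr fun q => by rw [List.map_map]; rfl

omit [Fact p.Prime] in
/-- The first bit of a block is the first bit of its first bit. [folklore] -/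
theorem bitOfBlock_take_one' {F : Type*} [Field F] (l : List Bool) : bitOfBlock F (l.take 1) = bitOfBlock F l := by
  cases l <;> rfl

/-! ### The decision procedure on codes -/

/-- **The decision procedure of the Razborov–Smolensky property runs in polynomial time**:
`rsDecide p` is computed on strings by an `FP` function.
[cite: CarmosinoImpagliazzoKabanetsKolokolova2016, Thm. 5.3 (constructivity)] -/
theorem codeFP_rsDecide : CodeFP strE bitE (rsDecide p) := by
  have hlen : CodeFP strE natE List.length := strNatLength
  have hbud : CodeFP strE unE (fun w => w.length + 1) := unSucc.comp strLength
  have hlog := codeFP_log2Fold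
  have hpw : CodeFP strE natE (fun w => (log2Fold w.length).1) := hlog.fst'
  have hn : CodeFP strE natE (fun w => (log2Fold w.length).2) := hlog.snd'
  -- the odd-length parameters `m = n`, `M = 2ⁿ`, in unary
  have hnU : CodeFP strE unE (fun w => (log2Fold w.length).2) :=
    (unOfNatMin.comp (hbud.pair hn)).congr fun w =>
      min_eq_left ((log2Fold_snd_le _).trans (Nat.le_succ _))
  have hMU : CodeFP strE unE (fun w => 2 ^ (log2Fold w.length).2) :=
    (unOfNatMin.comp (hbud.pair (natPow.comp ((const _ 2).pair hnU)))).congr fun w =>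
      min_eq_left (log2Fold_fst _ ▸ log2Fold_fst_le _)
  -- the even-length parameters `m = n - 1`, `M = 2^{n-1}`
  have hn1 : CodeFP strE natE (fun w => (log2Fold w.length).2 - 1) :=
    (natSub.comp (hn.pair (const _ 1))).congr fun _ => rfl
  have hn1U : CodeFP strE unE (fun w => (log2Fold w.length).2 - 1) :=
    (unOfNatMin.comp (hbud.pair hn1)).congr fun w =>
      min_eq_left ((Nat.sub_le _ _).trans ((log2Fold_snd_le _).trans (Nat.le_succ _)))
  have hM1U : CodeFP strE unE (fun w => 2 ^ ((log2Fold w.length).2 - 1)) :=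
    (unOfNatMin.comp (hbud.pair (natPow.comp ((const _ 2).pair hn1U)))).congr fun w =>
      min_eq_left (two_pow_pred_log2Fold_le _)
  -- the value lists
  have hglO : CodeFP strE (rowE p) (fun w => glOdd (ZMod p) (log2Fold w.length).2 w) :=
    (codeFP_glBlocks.comp (hMU.pair ((const strE 1).pair (CodeFP.id strE)))).congr fun _ => rfl
  have hglE : CodeFP strE (rowE p) (fun w => glEven (ZMod p) ((log2Fold w.length).2 - 1) w) :=
    (codeFP_glBlocks.comp (hM1U.pair ((const strE 2).pair (CodeFP.id strE)))).congr fun w => by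
      rw [glEven]
      refine List.map_congr_left fun i _ => ?_
      rw [bitOfBlock_take_one']
      rfl
  -- the two tests
  have hTO : CodeFP strE bitE (fun w => propTest (log2Fold w.length).2 (glOdd (ZMod p) (log2Fold w.length).2 w)) :=
    (codeFP_propTestU.comp ((hnU.pair hMU).pair hglO)).congr fun w => propTestU_two_pow _ _
  have hTE : CodeFP strE bitE (fun w => propTest ((log2Fold w.length).2 - 1)
      (glEven (ZMod p) ((log2Fold w.length).2 - 1) w)) :=
    (codeFP_propTestU.comp ((hn1U.pair hM1U).pair hglE)).congr fun w => propTestU_two_pow _ _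
  -- the case distinctions
  have c1 : CodeFP strE bitE (fun w => decide ((log2Fold w.length).1 = w.length)) :=
    (natEq.comp (hpw.pair hlen)).congr fun _ => rfl
  have c2 : CodeFP strE bitE (fun w => decide ((log2Fold w.length).2 = 0)) :=
    (natEq.comp (hn.pair (const _ 0))).congr fun _ => rfl
  have c3 : CodeFP strE bitE (fun w => decide ((log2Fold w.length).2 % 2 = 1)) :=
    (natEq.comp ((natMod.comp (hn.pair (const _ 2))).pair (const _ 1))).congr fun _ => rfl
  exact (c1.ite (c2.ite (const strE true) (c3.ite hTO hTE)) (const strE false)).congr fun w => by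
    simp only [rsDecide, decide_eq_true_eq]

/-- **The truth-table language of the Razborov–Smolensky property is in `P`** (constructivity;
CIKK Thm. 5.3 states `NC²`, this is its consequence `P`).
[cite: CarmosinoImpagliazzoKabanetsKolokolova2016, Thm. 5.3] -/
theorem isConstructive_rsProperty : IsConstructive Classes.P (rsProperty p) := by
  obtain ⟨g, hg, hgw⟩ := codeFP_rsDecide (p := p)
  rw [IsConstructive, CombinatorialProperty.toLanguage_eq, truthTableLanguage_rsProperty_eq]
  refine mem_P_of_mem_FP hg _ fun w => ⟨fun hw => ?_, fun hw => ?_⟩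
  · rw [show g w = bitE (rsDecide p w) from hgw w, show rsDecide p w = true from hw]; rfl
  · have : rsDecide p w = false := by
      cases h : rsDecide p w
      · rfl
      · exact absurd h hw
    rw [show g w = bitE (rsDecide p w) from hgw w, this]; rfl

/-- **The Razborov–Smolensky natural property, for every prime `p`** (Razborov–Rudich 1997, §3.2;
CIKK 2016, Thm. 5.3 — with `P` in place of `NC²` for constructivity, density `1/2` at every
length for largeness, and usefulness against `AC⁰[p]` in the sense of `NaturalProofs.lean`):
`rsProperty p` is `P`-constructive, `2^(2^n) ≤ 2·|rsProperty p n|` for all `n`, it is `P`-natural,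
and no language whose slices have the property infinitely often is in `AC⁰[p]`.
[cite: CarmosinoImpagliazzoKabanetsKolokolova2016, Thm. 5.3] -/
theorem rsProperty_natural (p : ℕ) [Fact p.Prime] :
    IsConstructive Classes.P (rsProperty p) ∧ (∀ n, 2 ^ (2 ^ n) ≤ 2 * Nat.card (rsProperty p n)) ∧
      IsNatural Classes.P (rsProperty p) ∧ IsUsefulAgainst (AC0Mod p) (rsProperty p) := by
  refine ⟨isConstructive_rsProperty, two_pow_le_two_mul_card_rsProperty p,
    ⟨rsProperty p, fun _ => subset_rfl, isConstructive_rsProperty, ?_⟩, isUsefulAgainst_AC0Mod_rsProperty⟩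
  refine ⟨1, Filter.eventually_atTop.2 ⟨1, fun n hn => (two_pow_le_two_mul_card_rsProperty p n).trans ?_⟩⟩
  refine Nat.mul_le_mul_right _ ?_
  calc 2 = 2 ^ 1 := rfl
    _ ≤ 2 ^ (1 * n) := Nat.pow_le_pow_right two_pos (by omega)

end Smolensky

end Literature.Computability.MetaComplexity
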